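import Summits.BirchSwinnertonDyer.Rank1Residual.Additive.WildThreeStableLineSignByC6
import Summits.BirchSwinnertonDyer.Rank1Residual.O5.NoLocalThreeTorsionTransport
import Summits.BirchSwinnertonDyer.BirchSwinnertonDyer.Theorems.CyclotomicUntwistPSTamagawaThreeLaw
import Summits.BirchSwinnertonDyer.BirchSwinnertonDyer.Theorems.CyclotomicUntwistThreeDivisionNewtonPolygon
import Summits.BirchSwinnertonDyer.Rank1Residual.GaloisImage.PadicThreeSquareClass
import HarnessLib

/-!
# LAW L-t3, part 2a: squares in `ℚ₃`, the bridge «`W(ℚ₃)[3] ≠ 0 ⟺` V10 shape `ET1`» on the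
# one-stable-line locus, and UNIQUENESS of the stable line of `Ψ₃` in E89's root regime with `3 ∤ v₃B`

Cell `pub/bsd-wall` (D-0145 line `route-BirchSwinnertonDyer-CyclotomicUntwist`), seat `bsd-line-cycu-p2`
(prover seat 2/3, gen 3), helper toward K1 `PSRankOneLowerHalfAtThree` (stmt-BirchSwinnertonDyer-21580) and
K2 `PSRankOneUpperHalfAtThree` (stmt-21581): the local condition at `3` of a `3`-descent on the PS rows.
THEOREMS ONLY (no definition, no named fact, no `sorry`); BSD is not proved by this file and no crux is.
Sequel of `…PSLocalThreeTorsionStar.lean` (p604483: `IV*`/`II*` rows have `W(ℚ₃)[3] = 0`) and of LAW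
L-c3 (`…PSTamagawaThreeLaw.lean`, p601441); it rides on the O6 lane's V10-SHAPE vocabulary
(`Additive/WildThreeResidualShape.lean`: `IsUniqueStableLineThree`, `stableLineSignThree`, `ShapeET1Three`,
`UnitPartCongThree`) and its `c₆`-dictionary (`Additive/WildThreeStableLineSignByC6.lean`, x11b3-p8:
`shapeET1Three_iff`), on harvest-2 E89's Newton polygon / Hensel root of the short model
(`PsiThreeAdic.psi3_exists_root_valuation_of_lt`) and on E111's point reading
(`exists_ne_zero_three_nsmul_iff_not_noLocalThreeTorsionAt`).

## What is proved

* §1 (`ℚ₃` squares) `isSquare_iff_even_valuation_and_unitPartCongThree_one` (`t ≠ 0` is a square in `ℚ₃`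
  iff `v₃ t` is even and its unit part is `≡ 1 (mod 3)`; the principal-unit half is the tree's
  `GaloisImage.LocalTorsion3.isSquare_of_norm_sub_one_lt_one`).
* §2 (bridge) **`not_noLocalThreeTorsionAt_iff_shapeET1Three`**: on the ONE-STABLE-LINE locus
  (`∃ x₀, IsUniqueStableLineThree W x₀`), `W(ℚ₃)[3] ≠ 0` (`¬ NoLocalThreeTorsionAt W 3`) iff the V10 shape
  is `ET1` (the stable line has the TRIVIAL character: its sign is a square).
* §3 (uniqueness of the stable line, pure `ℚ₃`) `psi3_root_valuation_eq` / `psi3_root_unique`: for the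
  short-model quartic `3x⁴ + 6Ax² + 12Bx − A²` in E89's root regime `2v₃B + 2 ≤ 3v₃A` with `3 ∤ v₃B`, EVERY
  `ℚ₃`-root has valuation `2v₃A − v₃B − 1` (the first Newton edge has length one and the second has the
  non-integral slope `−v₃B/3`: no tie is possible elsewhere) and two roots coincide (difference quotient
  dominated by `12B`).
* the sequel part 2b (`…PSLocalThreeTorsionEt.lean`) applies §3 to `W.toShortNF • W` and proves, on the
  Kodaira-`IV` rows of the route (`v₃Δ_min = 6`), `W(ℚ₃)[3] ≠ 0 ⟺ c₆(W_ℤ)/3⁵ % 3 = 1 ⟺ c₃ = 3`.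

Numerics (this seat, `census/lt3_check.py`, exact `3`-adic root isolation; EVIDENCE only): `81 ∥ N < 30 000`:
`IV` (`v = 6`) 554 curves, `E(ℚ₃)[3] ≠ 0` on 314, law 554/554; `II` (`v = 4`) 808, torsion on 424, law
`⟺ c₆/3³ ≡ 1` 808/808 (the `II` rows satisfy §3's hypotheses with `(v₃c₄, v₃c₆) = (2, 3)`; their Kraus
signature is not derived here).

References: J.-P. Serre, Invent. Math. 15 (1972) §1.11 [Serre1972]; J. E. Cremona, *Algorithms for Modular
Elliptic Curves* (1997) §3.8 [Cremona1997]; J. H. Silverman, *AEC* (2009) III.1, Ex. 3.7 [SilvermanAEC2009];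
*ATAEC* (1994) IV.9.4 Step 5 [SilvermanATAEC1994].
-/

set_option autoImplicit false
-- single-conjunct summit: `Summit.BirchSwinnertonDyer.BirchSwinnertonDyer.…` repeats the name by design
set_option linter.dupNamespace false

noncomputable section

open scoped Classical

open Polynomial WeierstrassCurve IsDedekindDomain Rat.HeightOneSpectrum
  Literature.NumberTheory.EllipticCurves Literature.NumberTheory.EllipticCurves.Rank1Residual
  Summit.BirchSwinnertonDyer.Rank1Residual.Additive Summit.BirchSwinnertonDyer.Rank1Residual.O5

namespace Summit.BirchSwinnertonDyer.BirchSwinnertonDyer.Theorems.PSLocalThreeTorsion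

/-! ## §1 Squares in `ℚ₃` -/

section Squares

/-- `t = 3^{v₃ t} · (unit part of t)` for `t ≠ 0`. [folklore] -/
theorem eq_zpow_mul_unitPartThree (t : ℚ_[3]) :
    t = ((3 : ℕ) : ℚ_[3]) ^ t.valuation * unitPartThree t := by
  unfold unitPartThree
  rw [mul_comm t, ← mul_assoc, ← zpow_add₀ (by norm_num : ((3 : ℕ) : ℚ_[3]) ≠ 0), add_neg_cancel,
    zpow_zero, one_mul]

/-- **Squares in `ℚ₃`**: a non-zero `t` is a square iff `v₃ t` is even and the unit part of `t` is
`≡ 1 (mod 3)`. [folklore] -/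
theorem isSquare_iff_even_valuation_and_unitPartCongThree_one {t : ℚ_[3]} (ht : t ≠ 0) :
    IsSquare t ↔ Even t.valuation ∧ UnitPartCongThree t 1 := by
  constructor
  · rintro ⟨s, hs⟩
    have hs0 : s ≠ 0 := by rintro rfl; exact ht (by rw [hs, mul_zero])
    refine ⟨⟨s.valuation, by rw [hs, Padic.valuation_mul hs0 hs0]⟩, ?_⟩
    unfold UnitPartCongThree
    rw [hs, unitPartThree_mul hs0 hs0]
    have hu : ‖unitPartThree s‖ = 1 := norm_unitPartThree hs0
    have e : unitPartThree s * unitPartThree s - 1 = (unitPartThree s - 1) * (unitPartThree s + 1) := by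
      ring
    rw [e, norm_mul]
    rcases unitPartCongThree_one_or_neg_one hs0 with h | h
    · have h' : ‖unitPartThree s + 1‖ ≤ 1 :=
        (Padic.nonarchimedean _ _).trans (max_le hu.le (by rw [norm_one]))
      have h1 : ‖unitPartThree s - 1‖ < 1 := h
      calc ‖unitPartThree s - 1‖ * ‖unitPartThree s + 1‖ ≤ ‖unitPartThree s - 1‖ * 1 :=
          mul_le_mul_of_nonneg_left h' (norm_nonneg _)
        _ < 1 := by rw [mul_one]; exact h1
    · have h' : ‖unitPartThree s - 1‖ ≤ 1 := by
        rw [sub_eq_add_neg]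
        exact (Padic.nonarchimedean _ _).trans (max_le hu.le (by rw [norm_neg, norm_one]))
      have h'' : ‖unitPartThree s + 1‖ < 1 := by
        have : unitPartThree s + 1 = unitPartThree s - (-1) := by ring
        rw [this]; exact h
      calc ‖unitPartThree s - 1‖ * ‖unitPartThree s + 1‖ ≤ 1 * ‖unitPartThree s + 1‖ :=
          mul_le_mul_of_nonneg_right h' (norm_nonneg _)
        _ < 1 := by rw [one_mul]; exact h''
  · rintro ⟨⟨m, hm⟩, hcong⟩
    obtain ⟨y, hy⟩ := Summit.BirchSwinnertonDyer.Rank1Residual.GaloisImage.LocalTorsion3.isSquare_of_norm_sub_one_lt_one hcong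
    refine ⟨((3 : ℕ) : ℚ_[3]) ^ m * y, ?_⟩
    rw [eq_zpow_mul_unitPartThree t, hm, hy, zpow_add₀ (by norm_num : ((3 : ℕ) : ℚ_[3]) ≠ 0)]
    ring

end Squares

/-! ## §2 The bridge: on the one-stable-line locus, `W(ℚ₃)[3] ≠ 0 ⟺` the V10 shape is `ET1` -/

section Bridge

variable (W : WeierstrassCurve ℚ) [W.IsElliptic]

omit [W.IsElliptic] in
/-- `¬ NoLocalThreeTorsionAt W 3` unfolded: some `ℚ₃`-root `x₀` of `Ψ₃` has `Ψ₂²(x₀)` a square.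
[folklore] -/
theorem not_noLocalThreeTorsionAt_iff_exists (ℓ : ℕ) [Fact ℓ.Prime] :
    ¬ NoLocalThreeTorsionAt W ℓ ↔ ∃ x₀ s : ℚ_[ℓ], ((W.baseChange ℚ_[ℓ]).Ψ₃).IsRoot x₀ ∧
      ((W.baseChange ℚ_[ℓ]).Ψ₂Sq).eval x₀ = s ^ 2 := by
  unfold NoLocalThreeTorsionAt
  constructor
  · intro h
    by_contra hne
    push Not at hne
    exact h fun x₀ s hx hs ↦ hne x₀ s hx hs
  · rintro ⟨x₀, s, hx, hs⟩ h
    exact h x₀ s hx hs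

/-- **Bridge.** For an elliptic `W/ℚ` whose `Ψ₃` has a UNIQUE `ℚ₃`-root (`IsUniqueStableLineThree`):
`W(ℚ₃)[3] ≠ 0` (`¬ NoLocalThreeTorsionAt W 3`) iff the V10 shape is `ET1` — the sign `Ψ₂²(x₀)` of the
stable line is a SQUARE in `ℚ₃` (`v₃` even, unit part `≡ 1`), i.e. `G_{ℚ₃}` acts trivially on the line.
[cite: Serre1972, §1.11] [cite: SilvermanAEC2009, Exercise 3.7 (d)] -/
theorem not_noLocalThreeTorsionAt_iff_shapeET1Three (h1 : ∃ x₀, IsUniqueStableLineThree W x₀) :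
    ¬ NoLocalThreeTorsionAt W 3 ↔ ShapeET1Three W := by
  obtain ⟨x₀, hx⟩ := h1
  have hF0 : stableLineSignThree W x₀ ≠ 0 := (valuation_stableLineSignThree W hx).1
  rw [not_noLocalThreeTorsionAt_iff_exists]
  constructor
  · rintro ⟨x, s, hr, hs⟩
    have hxx : x = x₀ := hx.2 x hr
    rw [hxx] at hs
    have hsq : IsSquare (stableLineSignThree W x₀) := ⟨s, by rw [← sq]; exact hs⟩
    obtain ⟨hev, hcong⟩ := (isSquare_iff_even_valuation_and_unitPartCongThree_one hF0).mp hsq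
    exact ⟨x₀, hx, hF0, hev, hcong⟩
  · rintro ⟨x₁, hx₁, hF1, hev, hcong⟩
    obtain ⟨s, hs⟩ := (isSquare_iff_even_valuation_and_unitPartCongThree_one hF1).mpr ⟨hev, hcong⟩
    exact ⟨x₁, s, hx₁.1, by rw [sq]; exact hs⟩

/-- **Point reading of the bridge**: on the one-stable-line locus, `W(ℚ₃)` has a point of order `3` iff
the shape is `ET1` (E111's `exists_ne_zero_three_nsmul_iff_not_noLocalThreeTorsionAt`).
[cite: SilvermanAEC2009, Exercise 3.7 (d),(f)] -/
theorem exists_three_torsion_iff_shapeET1Three (h1 : ∃ x₀, IsUniqueStableLineThree W x₀) :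
    (∃ P : (W.baseChange ℚ_[3]).toAffine.Point, P ≠ 0 ∧ 3 • P = 0) ↔ ShapeET1Three W := by
  rw [exists_ne_zero_three_nsmul_iff_not_noLocalThreeTorsionAt W 3,
    not_noLocalThreeTorsionAt_iff_shapeET1Three W h1]

end Bridge

/-! ## §3 Uniqueness of the stable line in E89's root regime with `3 ∤ v₃B` (pure `ℚ₃`) -/

section Unique

open Summit.BirchSwinnertonDyer.Rank1Residual.Additive.PsiThreeAdic
  Summit.BirchSwinnertonDyer.BirchSwinnertonDyer.Theorems.PSThreeDivision
  Literature.NumberTheory.QuadraticFields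

/-- **Every `ℚ₃`-root of `3x⁴ + 6Ax² + 12Bx − A²` has valuation `2v₃A − v₃B − 1`** when
`2v₃B + 2 ≤ 3v₃A` and `3 ∤ v₃B`: the terms have valuations `1 + 4t, 1 + v₃A + 2t, 1 + v₃B + t, 2v₃A`
at `v(x) = t`, and a tie of two minimal ones forces `t = 2v₃A − v₃B − 1` (the other candidate tie
`3t = v₃B` is excluded). [folklore] -/
theorem psi3_root_valuation_eq {A B : ℚ} (hA : A ≠ 0) (hB : B ≠ 0)
    (hlt : 2 * padicValRat 3 B + 2 ≤ 3 * padicValRat 3 A) (h3 : ¬ (3 : ℤ) ∣ padicValRat 3 B)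
    {x : ℚ_[3]}
    (hx : 3 * x ^ 4 + 6 * (A : ℚ_[3]) * x ^ 2 + 12 * (B : ℚ_[3]) * x - (A : ℚ_[3]) ^ 2 = 0) :
    x ≠ 0 ∧ x.valuation = 2 * padicValRat 3 A - padicValRat 3 B - 1 := by
  have hA' : (A : ℚ_[3]) ≠ 0 := by exact_mod_cast hA
  have hB' : (B : ℚ_[3]) ≠ 0 := by exact_mod_cast hB
  have hx0 : x ≠ 0 := by
    rintro rfl
    simp only [ne_eq, zero_pow, OfNat.ofNat_ne_zero, not_false_eq_true, mul_zero, add_zero,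
      zero_sub, neg_eq_zero, pow_eq_zero_iff] at hx
    exact hA' hx
  refine ⟨hx0, ?_⟩
  set ν := x.valuation with hν
  have h3ne : (3 : ℚ_[3]) ≠ 0 := by norm_num
  have h6ne : (6 : ℚ_[3]) ≠ 0 := by norm_num
  have h12ne : (12 : ℚ_[3]) ≠ 0 := by norm_num
  have hvA : (A : ℚ_[3]).valuation = padicValRat 3 A := Padic.valuation_ratCast A
  have hvB : (B : ℚ_[3]).valuation = padicValRat 3 B := Padic.valuation_ratCast B
  have ht4 : (3 * x ^ 4 : ℚ_[3]).valuation = 1 + 4 * ν := by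
    rw [Padic.valuation_mul h3ne (pow_ne_zero 4 hx0), Sqrt73.valuation_three', Padic.valuation_pow]
    push_cast; ring
  have ht2 : (6 * (A : ℚ_[3]) * x ^ 2).valuation = 1 + padicValRat 3 A + 2 * ν := by
    rw [Padic.valuation_mul (mul_ne_zero h6ne hA') (pow_ne_zero 2 hx0),
      Padic.valuation_mul h6ne hA', valuation_six, hvA, Padic.valuation_pow]
    push_cast; ring
  have ht1 : (12 * (B : ℚ_[3]) * x).valuation = 1 + padicValRat 3 B + ν := by
    rw [Padic.valuation_mul (mul_ne_zero h12ne hB') hx0, Padic.valuation_mul h12ne hB',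
      valuation_twelve, hvB]
  have ht0 : (-(A : ℚ_[3]) ^ 2).valuation = 2 * padicValRat 3 A := by
    rw [Sqrt41.valuation_neg'', Padic.valuation_pow, hvA]; push_cast; ring
  have ht4ne : (3 * x ^ 4 : ℚ_[3]) ≠ 0 := mul_ne_zero h3ne (pow_ne_zero 4 hx0)
  have ht2ne : (6 * (A : ℚ_[3]) * x ^ 2) ≠ 0 := mul_ne_zero (mul_ne_zero h6ne hA') (pow_ne_zero 2 hx0)
  have ht1ne : (12 * (B : ℚ_[3]) * x) ≠ 0 := mul_ne_zero (mul_ne_zero h12ne hB') hx0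
  have ht0ne : (-(A : ℚ_[3]) ^ 2) ≠ 0 := neg_ne_zero.mpr (pow_ne_zero 2 hA')
  have hsum :
      3 * x ^ 4 + 6 * (A : ℚ_[3]) * x ^ 2 + 12 * (B : ℚ_[3]) * x + (-(A : ℚ_[3]) ^ 2) = 0 := by
    rw [← hx]; ring
  have k4 := not_lt_of_add_four_eq_zero ht4ne hsum
  have k2 := not_lt_of_add_four_eq_zero ht2ne
    (show 6 * (A : ℚ_[3]) * x ^ 2 + 3 * x ^ 4 + 12 * (B : ℚ_[3]) * x + (-(A : ℚ_[3]) ^ 2) = 0 by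
      rw [← hsum]; ring)
  have k1 := not_lt_of_add_four_eq_zero ht1ne
    (show 12 * (B : ℚ_[3]) * x + 3 * x ^ 4 + 6 * (A : ℚ_[3]) * x ^ 2 + (-(A : ℚ_[3]) ^ 2) = 0 by
      rw [← hsum]; ring)
  have k0 := not_lt_of_add_four_eq_zero ht0ne
    (show (-(A : ℚ_[3]) ^ 2) + 3 * x ^ 4 + 6 * (A : ℚ_[3]) * x ^ 2 + 12 * (B : ℚ_[3]) * x = 0 by
      rw [← hsum]; ring)
  rw [ht4, ht2, ht1, ht0] at k4 k2 k1 k0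
  omega

/-- `‖q‖₃ = 3^{−v₃ q}` for a non-zero rational `q`. [folklore] -/
theorem norm_ratCast_eq_three_zpow {q : ℚ} (hq : q ≠ 0) :
    ‖(q : ℚ_[3])‖ = (3 : ℝ) ^ (-padicValRat 3 q) := by
  rw [norm_eq_three_zpow (by exact_mod_cast hq : (q : ℚ_[3]) ≠ 0), Padic.valuation_ratCast]

/-- **`Ψ₃` of the short model has at most one `ℚ₃`-root** in the regime `2v₃B + 2 ≤ 3v₃A`, `3 ∤ v₃B`:
for two roots `r ≠ s` (both of valuation `m = 2v₃A − v₃B − 1`) the difference quotient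
`3(r³ + r²s + rs² + s³) + 6A(r + s) + 12B` would vanish, but `12B` dominates it strictly
(`1 + v₃B < 1 + 3m` and `1 + v₃B < 1 + v₃A + m`). [folklore] -/
theorem psi3_root_unique {A B : ℚ} (hA : A ≠ 0) (hB : B ≠ 0)
    (hlt : 2 * padicValRat 3 B + 2 ≤ 3 * padicValRat 3 A) (h3 : ¬ (3 : ℤ) ∣ padicValRat 3 B)
    {r s : ℚ_[3]}
    (hr : 3 * r ^ 4 + 6 * (A : ℚ_[3]) * r ^ 2 + 12 * (B : ℚ_[3]) * r - (A : ℚ_[3]) ^ 2 = 0)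
    (hs : 3 * s ^ 4 + 6 * (A : ℚ_[3]) * s ^ 2 + 12 * (B : ℚ_[3]) * s - (A : ℚ_[3]) ^ 2 = 0) :
    r = s := by
  by_contra hne
  obtain ⟨hr0, hvr⟩ := psi3_root_valuation_eq hA hB hlt h3 hr
  obtain ⟨hs0, hvs⟩ := psi3_root_valuation_eq hA hB hlt h3 hs
  set m : ℤ := 2 * padicValRat 3 A - padicValRat 3 B - 1 with hm
  have hA' : (A : ℚ_[3]) ≠ 0 := by exact_mod_cast hA
  have hB' : (B : ℚ_[3]) ≠ 0 := by exact_mod_cast hB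
  -- the difference quotient vanishes
  have hQ : 12 * (B : ℚ_[3]) + (3 * (r ^ 3 + r ^ 2 * s + r * s ^ 2 + s ^ 3) +
      6 * (A : ℚ_[3]) * (r + s)) = 0 := by
    have h0 : (r - s) * (12 * (B : ℚ_[3]) + (3 * (r ^ 3 + r ^ 2 * s + r * s ^ 2 + s ^ 3) +
        6 * (A : ℚ_[3]) * (r + s))) = 0 := by
      linear_combination hr - hs
    exact (mul_eq_zero.mp h0).resolve_left (sub_ne_zero.mpr hne)
  -- norms
  have nr : ‖r‖ = (3 : ℝ) ^ (-m) := by rw [norm_eq_three_zpow hr0, hvr]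
  have ns : ‖s‖ = (3 : ℝ) ^ (-m) := by rw [norm_eq_three_zpow hs0, hvs]
  have n3 : ‖(3 : ℚ_[3])‖ = (3 : ℝ) ^ (-(1 : ℤ)) := by rw [norm_three, zpow_neg_one]
  have n6 : ‖(6 : ℚ_[3])‖ = (3 : ℝ) ^ (-(1 : ℤ)) := by
    rw [norm_eq_three_zpow (by norm_num), valuation_six]
  have n12 : ‖(12 : ℚ_[3])‖ = (3 : ℝ) ^ (-(1 : ℤ)) := by
    rw [norm_eq_three_zpow (by norm_num), valuation_twelve]
  have nA : ‖(A : ℚ_[3])‖ = (3 : ℝ) ^ (-padicValRat 3 A) := norm_ratCast_eq_three_zpow hA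
  have nB : ‖(B : ℚ_[3])‖ = (3 : ℝ) ^ (-padicValRat 3 B) := norm_ratCast_eq_three_zpow hB
  have h3pos : ∀ e : ℤ, (0 : ℝ) < (3 : ℝ) ^ e := fun e ↦ zpow_pos (by norm_num) e
  -- the cubic symmetric sum has norm ≤ 3^{-3m}
  have hmon : ∀ (i j : ℕ), i + j = 3 → ‖r ^ i * s ^ j‖ ≤ (3 : ℝ) ^ (-(3 * m)) := by
    intro i j hij
    rw [norm_mul, norm_pow, norm_pow, nr, ns, ← zpow_natCast, ← zpow_natCast, ← zpow_mul, ← zpow_mul,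
      three_zpow_mul]
    apply le_of_eq; congr 1
    have hij' : (i : ℤ) + (j : ℤ) = 3 := by exact_mod_cast hij
    linear_combination (-m) * hij'
  have hcub : ‖r ^ 3 + r ^ 2 * s + r * s ^ 2 + s ^ 3‖ ≤ (3 : ℝ) ^ (-(3 * m)) := by
    have e : r ^ 3 + r ^ 2 * s + r * s ^ 2 + s ^ 3 =
        r ^ 3 * s ^ 0 + r ^ 2 * s ^ 1 + r ^ 1 * s ^ 2 + r ^ 0 * s ^ 3 := by ring
    rw [e]
    refine (Padic.nonarchimedean _ _).trans (max_le ?_ (hmon 0 3 rfl))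
    refine (Padic.nonarchimedean _ _).trans (max_le ?_ (hmon 1 2 rfl))
    exact (Padic.nonarchimedean _ _).trans (max_le (hmon 3 0 rfl) (hmon 2 1 rfl))
  have hT1 : ‖3 * (r ^ 3 + r ^ 2 * s + r * s ^ 2 + s ^ 3)‖ < ‖12 * (B : ℚ_[3])‖ := by
    rw [norm_mul, n3, norm_mul, n12, nB, three_zpow_mul]
    calc (3 : ℝ) ^ (-(1 : ℤ)) * ‖r ^ 3 + r ^ 2 * s + r * s ^ 2 + s ^ 3‖
        ≤ (3 : ℝ) ^ (-(1 : ℤ)) * (3 : ℝ) ^ (-(3 * m)) := mul_le_mul_of_nonneg_left hcub (h3pos _).le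
      _ = (3 : ℝ) ^ (-(1 + 3 * m)) := by rw [three_zpow_mul]; congr 1; ring
      _ < (3 : ℝ) ^ (-(1 + padicValRat 3 B)) := by rw [three_zpow_neg_lt_iff]; omega
      _ = (3 : ℝ) ^ (-(1 : ℤ) + -padicValRat 3 B) := by congr 1; ring
  have hT2 : ‖6 * (A : ℚ_[3]) * (r + s)‖ < ‖12 * (B : ℚ_[3])‖ := by
    rw [norm_mul, norm_mul, n6, nA, norm_mul, n12, nB, three_zpow_mul, three_zpow_mul]
    have hrs : ‖r + s‖ ≤ (3 : ℝ) ^ (-m) :=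
      (Padic.nonarchimedean _ _).trans (max_le nr.le ns.le)
    calc (3 : ℝ) ^ (-(1 : ℤ) + -padicValRat 3 A) * ‖r + s‖
        ≤ (3 : ℝ) ^ (-(1 : ℤ) + -padicValRat 3 A) * (3 : ℝ) ^ (-m) :=
          mul_le_mul_of_nonneg_left hrs (h3pos _).le
      _ = (3 : ℝ) ^ (-(1 + padicValRat 3 A + m)) := by rw [three_zpow_mul]; congr 1; ring
      _ < (3 : ℝ) ^ (-(1 + padicValRat 3 B)) := by rw [three_zpow_neg_lt_iff]; omega
      _ = (3 : ℝ) ^ (-(1 : ℤ) + -padicValRat 3 B) := by congr 1; ring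
  have hR : ‖3 * (r ^ 3 + r ^ 2 * s + r * s ^ 2 + s ^ 3) + 6 * (A : ℚ_[3]) * (r + s)‖ <
      ‖12 * (B : ℚ_[3])‖ :=
    lt_of_le_of_lt (Padic.nonarchimedean _ _) (max_lt hT1 hT2)
  have h := norm_add_eq_of_lt hR
  rw [hQ, norm_zero] at h
  exact (mul_ne_zero (by norm_num) hB' : 12 * (B : ℚ_[3]) ≠ 0) (norm_eq_zero.mp h.symm)

end Unique

end Summit.BirchSwinnertonDyer.BirchSwinnertonDyer.Theorems.PSLocalThreeTorsion

end
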